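import Literature.AnabelianGeometry.EtaleTheta.Discharge.Sec5TowerFromLawsOfConnectedTemperoid
import Literature.AnabelianGeometry.EtaleTheta.Discharge.Sec5Prop52iOfConnectedTemperoidComp

/-!
# [EtTh] Prop. 5.2 (i) at EVERY level of the §5 data over the GENUINE connected base `B^temp(Π^tp_X)⁰`, for the root family
# BUILT FROM THE BASE-LEVEL LAWS — no `N`-domain binder (Prop. 5.2 (i) p. 324, Rmk. 4.3.2 pp. 318–319 / PDF pp. 98, 92–93)

Mochizuki, *The étale theta function and its Frobenioid-theoretic manifestations*, Publ. RIMS **45** (2009), Prop. 5.2 (i)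
p. 324 (PDF p. 98): «The pair of morphisms of `C` determined by "`s_{l·N}`", "`τ_{l·N}`" constitutes an `l·N`-th root of a right
fraction-pair … of … `Θ̈` …, or, alternatively, an `N`-th root of a right fraction-pair … of … an `l`-th root of … `Θ̈`
[cf. Remark 4.3.2]»; proof: «… follows immediately from the definition of the field `J̈_{l·N}` in §1»
[cite: MochizukiEtTh2009, Prop 5.2 (i) p.324 (PDF p.98); Rmk 4.3.2 p.318–319 (PDF pp.92–93)].

abc-iut cell, layer L2, PROOF-ONLY consumer companion (0 `def`s; seat abc-iut-w6-d053 gen 4, row «PROP 5.2 (i) AT EVERY LEVEL FROM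
THE LAWS»), node `EtTh:Prop5.2(i)`.  abc-iut-L2-t4's `ThetaFrobenioid.thetaPairIsRoot_ofConnectedTemperoidData_of_comp`
(`Sec5Prop52iOfConnectedTemperoidComp.lean`) gives Prop. 5.2 (i) — `FrobenioidThetaBiKummer.ThetaPairIsRoot`, BOTH printed
alternatives (the second holds by construction) — for the §5 data `ofConnectedTemperoidData` over `B^temp(Π^tp_X)⁰` with the model
pull-back, modulo THREE clauses on the `N`-domain `A_N` of the given root datum: `hsk` (skeleton through `A_⊙`), `hμ`
(`μ_{l·N}`-saturation), `hcondA` (Def. 4.1 (iii)(a) at level `l·N` — print's «definition of `J̈_{l·N}`»).  abc-iut-w5-d134's law-built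
compatible root family (`BiKummerSetting.exists_compatibleRootFamily_mkOfModelCanonical`, p439666; at the genuine base with `hS`
discharged: this seat's `exists_compatibleRootFamily_mkOfConnectedTemperoid`, p443359) CARRIES exactly these three clauses at every
level.  Hence:
* `ThetaFrobenioid.exists_rootFamily_thetaPairIsRoot_ofConnectedTemperoid` — from the [FrdI] Thm. 5.2 hypotheses `h`, the laws
  `hDSpull` / `hR` / `hEdiv` and an `l`-th root datum `Rl` of `Θ̈`'s pair (`hskl`, `hfixl`): a root family `R N` (`N ≥ 1`) such that
  for EVERY level `N`, every §2 datum `T` / identification `ιX`, all constants and all divisor invariances, **Prop. 5.2 (i) holds for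
  the §5 data `ofConnectedTemperoidData … (R N) …` with NO `N`-domain binder**;
* `…_of_baseRootLaw` — the same with the ERRATUM-E2 root law re-keyed on abc-iut-L2-t3's named predicate
  `TemperedFrobenioid.BaseRootLaw` (census A10) + `hTF` (`TemperedFrobenioid.rootLaw_of_baseRootLaw'`).
Nothing landed is edited or restated; every named input is consumed BY NAME.
HONEST FRAMING: kernel-checked consequences of the named base-level laws for data so typed (labels of record: the law set is
satisfiable at the Kummer toy tower, `Sec5RootChainNonVacuityToyTower.lean`; A10 has no instance in the tree's `GaloisAction`
model class, F-L2t3g5-1); nothing asserts that such data exist for an actual curve; typed ≠ proved for the laws; no side is taken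
on [IUTchIII] Cor. 3.12.
-/

noncomputable section

namespace Literature.AnabelianGeometry.EtaleTheta

open CategoryTheory Opposite Literature.AlgebraicGeometry.Frobenioids Literature.AnabelianGeometry.SemiGraphs
  Literature.AnabelianGeometry.SemiGraphs.GaloisObjects

universe u₀ v₀ w

namespace ThetaFrobenioid

variable {K : Type u₀} [Field K] {X : SemiGraphs.TemperedArithmeticGroup.{u₀} K} {D₀ : Type u₀} [Category.{v₀} D₀]
  {V : FrdIMonoidStub.{w}} {T₀ : RealifiedDivisorMonoids (D₀ := D₀) V}
  {VD : FrdICatStub.{u₀ + 1, u₀, w} (ConnectedPart (BTemp X.Pi))}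
  {tf : TemperedFrobenioid T₀ (ConnectedPart (BTemp X.Pi)) VD} {hZ : tf.monoidType = MonoidType.Z}
  {hP : ∀ A : (ConnectedPart (BTemp X.Pi))ᵒᵖ, IsPerfect (tf.Φ.carrier A)}
  {NH : Subgroup (Field.absoluteGaloisGroup K) → tf.category → ℕ+ → Prop} {A₀ : tf.category}
  {hA₀ : PreFrobenioid.IsFrobeniusTrivial tf.toElem A₀} {hA₀' : SemiGraphs.IsGaloisObj A₀.base.obj}
  {lv : ℕ+} {θ : tf.biratUnitsModel A₀} {Bl : tf.category}
  {Pl : (BiKummerSetting.mkOfConnectedTemperoid X tf hZ hP NH A₀ hA₀ hA₀').FractionPair θ Bl}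
  (h : ModelFrobenioid.Hypotheses tf.divisorMonoid tf.ratFnFunctor)
  (Rl : (BiKummerSetting.mkOfConnectedTemperoid X tf hZ hP NH A₀ hA₀ hA₀').NthRoot θ Pl lv
    (fun {_} φ x => tf.pullFracModel φ x))
  (hDSpull : ∀ {A A' : ConnectedPart (BTemp X.Pi)} (e : A' ⟶ A) {a b : tf.Φ.carrier (op A)},
    (∀ x : tf.Φ.carrier (op A), x ∣ a → x ∣ b → x = 1) →
      ∀ y : tf.Φ.carrier (op A'), y ∣ pull tf.divisorMonoid e a → y ∣ pull tf.divisorMonoid e b → y = 1)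
  (hEdiv : ∀ (M : ℕ+) (A' : tf.category), PreFrobenioid.IsFrobeniusTrivial tf.toElem A' →
    SemiGraphs.IsGaloisObj A'.base.obj →
      ∃ (A'' : tf.category) (ψ : A'' ⟶ A'), PreFrobenioid.IsPullbackMorphism tf.toElem ψ ∧
        SemiGraphs.IsGaloisObj A''.base.obj ∧ tf.IsMuSaturated A'' M ∧
          ∀ N : ℕ+, (N : ℕ) ∣ (M : ℕ) → NH (BiKummerSetting.mkOfConnectedTemperoid X tf hZ hP NH A₀ hA₀ hA₀').HodotBsFld A'' N)
  (hskl : Nonempty (Rl.AN.base ≅ A₀.base) → Rl.AN = A₀)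
  (hfixl : (BiKummerSetting.mkOfConnectedTemperoid X tf hZ hP NH A₀ hA₀ hA₀').IsFixedByHA Rl.AN Rl.αData.isGalois Rl.root)
  (Q : FrobenioidTheta.ThetaSubquotientStub.{w} (ConnectedPart (BTemp X.Pi))) (odd_l : Odd (lv : ℕ))

include hDSpull hEdiv hskl hfixl in
/-- **[EtTh] Prop. 5.2 (i) at EVERY level for the law-built root family over `B^temp(Π^tp_X)⁰` — no `N`-domain binder.**  From
`h`, `hDSpull`, the E2 root law `hR`, `hEdiv` and the `l`-th root datum `Rl` (`hskl`, `hfixl`): a family `R N` (`N ≥ 1`) of `N`-th root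
data of `Rl`'s fraction-pair such that, for every `N`, every §2 datum `T` with `ιX`, all constants and all divisor invariances
`hinvc`/`hinvp`, the §5 data `ofConnectedTemperoidData … (R N) …` satisfy `ThetaPairIsRoot` — `(s^⊓_N, s^⊔_N)` «constitutes an
`l·N`-th root of a right fraction-pair of `Θ̈`, or, alternatively, an `N`-th root of a right fraction-pair of an `l`-th root of `Θ̈`»
(abc-iut-L2-t4's `thetaPairIsRoot_ofConnectedTemperoidData_of_comp` fed with the three clauses the family carries).
[cite: MochizukiEtTh2009, Prop 5.2 (i) p.324 (PDF p.98); Rmk 4.3.2 p.318–319 (PDF pp.92–93)] -/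
theorem exists_rootFamily_thetaPairIsRoot_ofConnectedTemperoid
    (hR : ∀ (N : ℕ+) (A : ConnectedPart (BTemp X.Pi)), SemiGraphs.IsGaloisObj A.obj → ∀ f : tf.ratFnFunctor.obj (op A),
      ∃ (A' : ConnectedPart (BTemp X.Pi)) (_ : SemiGraphs.IsGaloisObj A'.obj) (b : A' ⟶ A) (g : tf.ratFnFunctor.obj (op A')),
        g ^ (N : ℕ) = pull tf.ratFnFunctor b f) :
    ∃ R : ∀ N : ℕ+, (BiKummerSetting.mkOfConnectedTemperoid X tf hZ hP NH A₀ hA₀ hA₀').NthRoot Rl.root Rl.pair N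
        (fun {_} φ x => tf.pullFracModel φ x),
      ∀ (N : ℕ+) (T : ThetaEnvData.{max u₀ w} N) (ιX : T.PiX ≃ₜ* X.Pi) (K' : Type w) [Field K']
        (constEmb : K'ˣ →* tf.biratUnitsModel (R N).BN) (constEmb_injective : Function.Injective constEmb)
        (hinvc : ∀ g : Aut (R N).AN.base,
          pull tf.divisorMonoid g.hom (ModelFrobenioid.div (R N).pair.num) = ModelFrobenioid.div (R N).pair.num)
        (hinvp : ∀ y : T.PiX, y ∈ T.PiYdd →
          pull tf.divisorMonoid ((BiKummerSetting.mkOfConnectedTemperoid X tf hZ hP NH A₀ hA₀ hA₀').galoisSurj (R N).AN.base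
            (R N).αData.isGalois (ιX y)).hom (ModelFrobenioid.div (R N).pair.den) = ModelFrobenioid.div (R N).pair.den),
        FrobenioidThetaBiKummer.ThetaPairIsRoot
          (ofConnectedTemperoidData (pullFrac := fun {_ _} φ x => tf.pullFracModel φ x) h Q odd_l (R N) ιX K' constEmb
            constEmb_injective hinvc hinvp)
          (FrobenioidThetaBiKummer.BiKummerVocabStub.ofBiKummerSetting
            (BiKummerSetting.mkOfConnectedTemperoid X tf hZ hP NH A₀ hA₀ hA₀') (fun {_ _} φ x => tf.pullFracModel φ x) _
            fun _ => (MulEquiv.ofBijective (MonoidHom.id _) Function.bijective_id).symm) :=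
  (BiKummerSetting.exists_compatibleRootFamily_mkOfConnectedTemperoid X tf hZ hP NH A₀ hA₀ hA₀' h.isDivisorial hDSpull hR hEdiv
      Rl.αData.isFrobeniusTrivial Rl.αData.isGalois hskl hfixl Rl.pair lv).elim fun R hR' =>
    ⟨R, fun N _ ιX K' _ constEmb constEmb_injective hinvc hinvp =>
      thetaPairIsRoot_ofConnectedTemperoidData_of_comp h Q odd_l (R N) ιX K' constEmb constEmb_injective hinvc hinvp
        (hR'.1 N).1 (hR'.1 N).2.1 (hR'.1 N).2.2⟩

include hDSpull hEdiv hskl hfixl in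
/-- **The same, the ERRATUM-E2 root law re-keyed on the named predicate `TemperedFrobenioid.BaseRootLaw`** (census A10) + `hTF`
(`TemperedFrobenioid.rootLaw_of_baseRootLaw'`).  [cite: MochizukiEtTh2009, Prop 5.2 (i) p.324 (PDF p.98); Prop 4.2 (iii) p.315 (PDF p.89)] -/
theorem exists_rootFamily_thetaPairIsRoot_ofConnectedTemperoid_of_baseRootLaw
    (hTF : ∀ (A : ConnectedPart (BTemp X.Pi)) (N : ℕ), 0 < N →
      Function.Injective fun x : Algebra.GrothendieckGroup (T₀.ΦR.obj (op (tf.base.obj A))) => x ^ N)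
    (hR₀ : tf.BaseRootLaw fun A : ConnectedPart (BTemp X.Pi) => SemiGraphs.IsGaloisObj A.obj) :
    ∃ R : ∀ N : ℕ+, (BiKummerSetting.mkOfConnectedTemperoid X tf hZ hP NH A₀ hA₀ hA₀').NthRoot Rl.root Rl.pair N
        (fun {_} φ x => tf.pullFracModel φ x),
      ∀ (N : ℕ+) (T : ThetaEnvData.{max u₀ w} N) (ιX : T.PiX ≃ₜ* X.Pi) (K' : Type w) [Field K']
        (constEmb : K'ˣ →* tf.biratUnitsModel (R N).BN) (constEmb_injective : Function.Injective constEmb)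
        (hinvc : ∀ g : Aut (R N).AN.base,
          pull tf.divisorMonoid g.hom (ModelFrobenioid.div (R N).pair.num) = ModelFrobenioid.div (R N).pair.num)
        (hinvp : ∀ y : T.PiX, y ∈ T.PiYdd →
          pull tf.divisorMonoid ((BiKummerSetting.mkOfConnectedTemperoid X tf hZ hP NH A₀ hA₀ hA₀').galoisSurj (R N).AN.base
            (R N).αData.isGalois (ιX y)).hom (ModelFrobenioid.div (R N).pair.den) = ModelFrobenioid.div (R N).pair.den),
        FrobenioidThetaBiKummer.ThetaPairIsRoot
          (ofConnectedTemperoidData (pullFrac := fun {_ _} φ x => tf.pullFracModel φ x) h Q odd_l (R N) ιX K' constEmb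
            constEmb_injective hinvc hinvp)
          (FrobenioidThetaBiKummer.BiKummerVocabStub.ofBiKummerSetting
            (BiKummerSetting.mkOfConnectedTemperoid X tf hZ hP NH A₀ hA₀ hA₀') (fun {_ _} φ x => tf.pullFracModel φ x) _
            fun _ => (MulEquiv.ofBijective (MonoidHom.id _) Function.bijective_id).symm) :=
  exists_rootFamily_thetaPairIsRoot_ofConnectedTemperoid h Rl hDSpull hEdiv hskl hfixl Q odd_l
    (fun N A hA f => tf.rootLaw_of_baseRootLaw' (fun A : ConnectedPart (BTemp X.Pi) => SemiGraphs.IsGaloisObj A.obj) hP hTF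
      hR₀ N A hA f)

end ThetaFrobenioid

end Literature.AnabelianGeometry.EtaleTheta

end
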